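import Mathlib
import Summits.ValiantsHypothesis.ValiantsHypothesis.Theorems.KPlusLogSqLawStepSupStructure

/-!
# The ZIGZAG LAW for two consecutive plateau steps (static path model behind `KPlusLogSqLaw.TropicalB`)

Cell pub-symmetroid, seat conjb-2 (g21). A helper toward the crux `TropicalB`
(`Summit.ValiantsHypothesis.ValiantsHypothesis.Theses.KPlusLogSqLaw.TropicalB`, item
`stmt-ValiantsHypothesis-19771`); it earns no crux credit and is not evidence for `MatrixDescartes` or for
Valiant's hypothesis.

Lines `S t θ = b t + s t * θ`, windows separated when the even-indexed lines lie strictly above the odd-indexed ones,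
`T[u, v]` = the separation set of the window `[u, v]`; a step at row `i` (reach `d`): `T[i, i+d]`, `T[i+1, i+d+1]`
non-empty and disjoint (THEORY-NOTE-g21 §3).

THEOREM (ZIGZAG LAW, THEORY-NOTE-g21 §3.1quater). If rows `i` and `i+1` both step (odd reach `d`) and the two
steps go in OPPOSITE directions — `T[i, i+d]` and `T[i+2, i+d+2]` lie on the same side of `T[i+1, i+d+1]` — then the
slope of the line `i+d+1` lies strictly between those of the lines `i+1` and `i+d+2`: the «between» witness of the
STEP LEMMA for row `i+1` must be the new line `i+d+1` itself. Reason (look-back): at the end `ρ` of `T[i+1, i+d+1]`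
facing `T[i+2, i+d+2]` the outer line `i+1` meets a tight line `x` of the other class
(`KPlusLogSqLawStepSupStructure.step_sup_structure`); the comparison of `x` and `i+1` vanishes at `ρ` and is
positive on `T[i+1, i+d+1]`, hence non-positive beyond `ρ`, where `T[i, i+d]` lives; so `x` is not a line of
`[i, i+d]`, i.e. `x = i+d+1`.

Together with the STEP CRITERION (§3.1bis) at rows `i`, `i+1` and the CONTINUATION LAW (§3.1ter) at row `i`, this is
the located-exact TWO-STEP PLATEAU CRITERION of §3.1quater (every {±1,±2} slope word at reach 3, 5, 7: 512 + 8 192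
+ 37 919 words, realisable ⟺ the four conditions; this file proves the necessity of the fourth).

* `zigzag_core` — class `up` of upper lines, row `i` moving right, row `i+1` moving left;
* `zigzag_even_rl`, `zigzag_even_lr` — even first line, directions (right, left) / (left, right), the second by
  `θ ↦ -θ`; the odd-first-line cases are in `KPlusLogSqLawStepZigzagOdd` (negated lines).
-/

set_option linter.dupNamespace false

namespace Summit.ValiantsHypothesis.ValiantsHypothesis.Theorems.KPlusLogSqLawStepZigzag

open Summit.ValiantsHypothesis.ValiantsHypothesis.Theorems.KPlusLogSqLawStepSupStructure (step_sup_structure)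

/-- ZIGZAG LAW, core: class `up` of upper lines (`i+d+1` upper, `i+1`, `i+d+2` not), row `i` moving right
(`T[i, i+d]` left of `T[i+1, i+d+1]`), row `i+1` moving left (`T[i+2, i+d+2]` left of `T[i+1, i+d+1]`). -/
theorem zigzag_core (up : ℕ → Prop) (s b : ℕ → ℝ) (i d : ℕ) (hlow1 : ¬ up (i + 1)) (hup1 : up (i + d + 1))
    (hlow2 : ¬ up (i + d + 2)) (hd : 1 ≤ d)
    (hA : ∃ θ : ℝ, ∀ e o : ℕ, i ≤ e → e ≤ i + d → i ≤ o → o ≤ i + d → up e → ¬ up o →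
      b o + s o * θ < b e + s e * θ)
    (hB : ∃ θ : ℝ, ∀ e o : ℕ, i + 1 ≤ e → e ≤ i + d + 1 → i + 1 ≤ o → o ≤ i + d + 1 → up e → ¬ up o →
      b o + s o * θ < b e + s e * θ)
    (hord : ∀ θ θ' : ℝ, (∀ e o : ℕ, i ≤ e → e ≤ i + d → i ≤ o → o ≤ i + d → up e → ¬ up o →
      b o + s o * θ < b e + s e * θ) → (∀ e o : ℕ, i + 1 ≤ e → e ≤ i + d + 1 → i + 1 ≤ o → o ≤ i + d + 1 →
      up e → ¬ up o → b o + s o * θ' < b e + s e * θ') → θ < θ')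
    (hB' : ∃ θ : ℝ, ∀ e o : ℕ, i + 2 ≤ e → e ≤ i + d + 2 → i + 2 ≤ o → o ≤ i + d + 2 → up e → ¬ up o →
      b o + s o * θ < b e + s e * θ)
    (hBB' : ∀ θ : ℝ, ¬ ((∀ e o : ℕ, i + 1 ≤ e → e ≤ i + d + 1 → i + 1 ≤ o → o ≤ i + d + 1 → up e → ¬ up o →
      b o + s o * θ < b e + s e * θ) ∧ (∀ e o : ℕ, i + 2 ≤ e → e ≤ i + d + 2 → i + 2 ≤ o → o ≤ i + d + 2 →
      up e → ¬ up o → b o + s o * θ < b e + s e * θ)))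
    (hR : ∀ θ θ' : ℝ, (∀ e o : ℕ, i + 1 ≤ e → e ≤ i + d + 1 → i + 1 ≤ o → o ≤ i + d + 1 → up e → ¬ up o →
      b o + s o * θ < b e + s e * θ) → (∀ e o : ℕ, i + 2 ≤ e → e ≤ i + d + 2 → i + 2 ≤ o → o ≤ i + d + 2 →
      up e → ¬ up o → b o + s o * θ' < b e + s e * θ') → θ' < θ) :
    s (i + 1) < s (i + d + 1) ∧ s (i + d + 1) < s (i + d + 2) := by
  classical
  obtain ⟨θA, hθA⟩ := hA
  obtain ⟨θB, hθB⟩ := hB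
  obtain ⟨θB', hθB'⟩ := hB'
  have hlow' : ∃ x : ℕ, i + 1 + 1 ≤ x ∧ x ≤ i + 1 + d ∧ ¬ (¬ up x) :=
    ⟨i + d + 1, by omega, by omega, fun h => h hup1⟩
  have hlow2' : ¬ up (i + 1 + d + 1) := by
    rw [show i + 1 + d + 1 = i + d + 2 by omega]
    exact hlow2
  -- structure theorem for row `i+1` on the negated lines with `θ ↦ -θ` (its step moves left)
  obtain ⟨ρ', x, hx1, hx2, hxu, hsx1, hsx2, hxeq, -, -, happ₁, -⟩ :=
    step_sup_structure (fun n => ¬ up n) s (fun t => - b t) (i + 1) d hlow1 hlow2' hlow'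
      ⟨-θB, fun e o' h1 h2 h3 h4 he ho' => by
        have := hθB o' e h3 (by omega) h1 (by omega) (not_not.mp ho') he
        have r1 : s o' * (-θB) = -(s o' * θB) := by ring
        have r2 : s e * (-θB) = -(s e * θB) := by ring
        linarith⟩
      ⟨-θB', fun e o' h1 h2 h3 h4 he ho' => by
        have := hθB' o' e (by omega) (by omega) (by omega) (by omega) (not_not.mp ho') he
        have r1 : s o' * (-θB') = -(s o' * θB') := by ring
        have r2 : s e * (-θB') = -(s e * θB') := by ring
        linarith⟩
      (fun θ hθ => hBB' (-θ)
        ⟨fun e o' h1 h2 h3 h4 he ho' => by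
          have := hθ.1 o' e h3 (by omega) h1 (by omega) ho' (not_not.mpr he)
          have r1 : s o' * (-θ) = -(s o' * θ) := by ring
          have r2 : s e * (-θ) = -(s e * θ) := by ring
          linarith,
         fun e o' h1 h2 h3 h4 he ho' => by
          have := hθ.2 o' e (by omega) (by omega) (by omega) (by omega) ho' (not_not.mpr he)
          have r1 : s o' * (-θ) = -(s o' * θ) := by ring
          have r2 : s e * (-θ) = -(s e * θ) := by ring
          linarith⟩)
      (fun θ θ' hθ hθ' => by
        have := hR (-θ) (-θ')
          (fun e o' h1 h2 h3 h4 he ho' => by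
            have := hθ o' e h3 (by omega) h1 (by omega) ho' (not_not.mpr he)
            have r1 : s o' * (-θ) = -(s o' * θ) := by ring
            have r2 : s e * (-θ) = -(s e * θ) := by ring
            linarith)
          (fun e o' h1 h2 h3 h4 he ho' => by
            have := hθ' o' e (by omega) (by omega) (by omega) (by omega) ho' (not_not.mpr he)
            have r1 : s o' * (-θ') = -(s o' * θ') := by ring
            have r2 : s e * (-θ') = -(s e * θ') := by ring
            linarith)
        linarith)
  -- the separation point `θA` of `[i, i+d]` lies at or below `ρ = -ρ'`
  have hle : θA ≤ -ρ' := by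
    by_contra hcon
    have hlt : -ρ' < θA := lt_of_not_ge hcon
    obtain ⟨θ, hθ, hθlt⟩ := happ₁ (ρ' + θA) (by linarith)
    have hsep : ∀ e o' : ℕ, i + 1 ≤ e → e ≤ i + d + 1 → i + 1 ≤ o' → o' ≤ i + d + 1 → up e → ¬ up o' →
        b o' + s o' * (-θ) < b e + s e * (-θ) := by
      intro e o' h1 h2 h3 h4 he ho'
      have := hθ o' e h3 (by omega) h1 (by omega) ho' (not_not.mpr he)
      have r1 : s o' * (-θ) = -(s o' * θ) := by ring
      have r2 : s e * (-θ) = -(s e * θ) := by ring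
      linarith
    have := hord θA (-θ) hθA hsep
    linarith
  -- the tight line `x` is not a line of `[i, i+d]`: there its comparison with `i+1` would be positive at `θA ≤ ρ`
  have hx : x = i + d + 1 := by
    by_contra hne
    have hxle : x ≤ i + d := by omega
    have dA := hθA x (i + 1) (by omega) hxle (by omega) (by omega) (not_not.mp hxu) hlow1
    have p : 0 ≤ (s x - s (i + 1)) * (-ρ' - θA) := mul_nonneg (by linarith) (by linarith)
    have i1 : (b x + s x * θA) - (b (i + 1) + s (i + 1) * θA)
        = ((b x - s x * ρ') - (b (i + 1) - s (i + 1) * ρ')) - (s x - s (i + 1)) * (-ρ' - θA) := by ring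
    have heq : (b x - s x * ρ') - (b (i + 1) - s (i + 1) * ρ') = 0 := by linarith
    linarith
  subst hx
  refine ⟨hsx1, ?_⟩
  rw [show i + d + 2 = i + 1 + d + 1 by omega]
  exact hsx2

/-- ZIGZAG LAW, even first line, row `i` moving right and row `i+1` moving left. -/
theorem zigzag_even_rl (s b : ℕ → ℝ) (i d : ℕ) (hi : Even i) (hd : Odd d)
    (hA : ∃ θ : ℝ, ∀ e o : ℕ, i ≤ e → e ≤ i + d → i ≤ o → o ≤ i + d → Even e → Odd o →
      b o + s o * θ < b e + s e * θ)
    (hB : ∃ θ : ℝ, ∀ e o : ℕ, i + 1 ≤ e → e ≤ i + d + 1 → i + 1 ≤ o → o ≤ i + d + 1 → Even e → Odd o →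
      b o + s o * θ < b e + s e * θ)
    (hord : ∀ θ θ' : ℝ, (∀ e o : ℕ, i ≤ e → e ≤ i + d → i ≤ o → o ≤ i + d → Even e → Odd o →
      b o + s o * θ < b e + s e * θ) → (∀ e o : ℕ, i + 1 ≤ e → e ≤ i + d + 1 → i + 1 ≤ o → o ≤ i + d + 1 →
      Even e → Odd o → b o + s o * θ' < b e + s e * θ') → θ < θ')
    (hB' : ∃ θ : ℝ, ∀ e o : ℕ, i + 2 ≤ e → e ≤ i + d + 2 → i + 2 ≤ o → o ≤ i + d + 2 → Even e → Odd o →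
      b o + s o * θ < b e + s e * θ)
    (hBB' : ∀ θ : ℝ, ¬ ((∀ e o : ℕ, i + 1 ≤ e → e ≤ i + d + 1 → i + 1 ≤ o → o ≤ i + d + 1 → Even e →
      Odd o → b o + s o * θ < b e + s e * θ) ∧ (∀ e o : ℕ, i + 2 ≤ e → e ≤ i + d + 2 → i + 2 ≤ o →
      o ≤ i + d + 2 → Even e → Odd o → b o + s o * θ < b e + s e * θ)))
    (hR : ∀ θ θ' : ℝ, (∀ e o : ℕ, i + 1 ≤ e → e ≤ i + d + 1 → i + 1 ≤ o → o ≤ i + d + 1 → Even e → Odd o →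
      b o + s o * θ < b e + s e * θ) → (∀ e o : ℕ, i + 2 ≤ e → e ≤ i + d + 2 → i + 2 ≤ o → o ≤ i + d + 2 →
      Even e → Odd o → b o + s o * θ' < b e + s e * θ') → θ' < θ) :
    s (i + 1) < s (i + d + 1) ∧ s (i + d + 1) < s (i + d + 2) := by
  have hlow1 : ¬ Even (i + 1) := Nat.not_even_iff_odd.mpr (Even.add_one hi)
  have hd1 : 1 ≤ d := by
    obtain ⟨l, hl⟩ := hd
    omega
  have hup1 : Even (i + d + 1) := by
    obtain ⟨k, hk⟩ := hi
    obtain ⟨l, hl⟩ := hd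
    exact ⟨k + l + 1, by omega⟩
  have hlow2 : ¬ Even (i + d + 2) := by
    obtain ⟨k, hk⟩ := hi
    obtain ⟨l, hl⟩ := hd
    exact Nat.not_even_iff_odd.mpr ⟨k + l + 1, by omega⟩
  obtain ⟨θA, hθA⟩ := hA
  obtain ⟨θB, hθB⟩ := hB
  obtain ⟨θB', hθB'⟩ := hB'
  exact zigzag_core (fun n => Even n) s b i d hlow1 hup1 hlow2 hd1
    ⟨θA, fun e o h1 h2 h3 h4 he ho => hθA e o h1 h2 h3 h4 he (Nat.not_even_iff_odd.mp ho)⟩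
    ⟨θB, fun e o h1 h2 h3 h4 he ho => hθB e o h1 h2 h3 h4 he (Nat.not_even_iff_odd.mp ho)⟩
    (fun θ θ' hθ hθ' => hord θ θ'
      (fun e o h1 h2 h3 h4 he ho => hθ e o h1 h2 h3 h4 he (Nat.not_even_iff_odd.mpr ho))
      (fun e o h1 h2 h3 h4 he ho => hθ' e o h1 h2 h3 h4 he (Nat.not_even_iff_odd.mpr ho)))
    ⟨θB', fun e o h1 h2 h3 h4 he ho => hθB' e o h1 h2 h3 h4 he (Nat.not_even_iff_odd.mp ho)⟩
    (fun θ hθ => hBB' θ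
      ⟨fun e o h1 h2 h3 h4 he ho => hθ.1 e o h1 h2 h3 h4 he (Nat.not_even_iff_odd.mpr ho),
       fun e o h1 h2 h3 h4 he ho => hθ.2 e o h1 h2 h3 h4 he (Nat.not_even_iff_odd.mpr ho)⟩)
    (fun θ θ' hθ hθ' => hR θ θ'
      (fun e o h1 h2 h3 h4 he ho => hθ e o h1 h2 h3 h4 he (Nat.not_even_iff_odd.mpr ho))
      (fun e o h1 h2 h3 h4 he ho => hθ' e o h1 h2 h3 h4 he (Nat.not_even_iff_odd.mpr ho)))
/-- ZIGZAG LAW, even first line, row `i` moving left and row `i+1` moving right (by `θ ↦ -θ`). -/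
theorem zigzag_even_lr (s b : ℕ → ℝ) (i d : ℕ) (hi : Even i) (hd : Odd d)
    (hA : ∃ θ : ℝ, ∀ e o : ℕ, i ≤ e → e ≤ i + d → i ≤ o → o ≤ i + d → Even e → Odd o →
      b o + s o * θ < b e + s e * θ)
    (hB : ∃ θ : ℝ, ∀ e o : ℕ, i + 1 ≤ e → e ≤ i + d + 1 → i + 1 ≤ o → o ≤ i + d + 1 → Even e → Odd o →
      b o + s o * θ < b e + s e * θ)
    (hord : ∀ θ θ' : ℝ, (∀ e o : ℕ, i ≤ e → e ≤ i + d → i ≤ o → o ≤ i + d → Even e → Odd o →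
      b o + s o * θ < b e + s e * θ) → (∀ e o : ℕ, i + 1 ≤ e → e ≤ i + d + 1 → i + 1 ≤ o → o ≤ i + d + 1 →
      Even e → Odd o → b o + s o * θ' < b e + s e * θ') → θ' < θ)
    (hB' : ∃ θ : ℝ, ∀ e o : ℕ, i + 2 ≤ e → e ≤ i + d + 2 → i + 2 ≤ o → o ≤ i + d + 2 → Even e → Odd o →
      b o + s o * θ < b e + s e * θ)
    (hBB' : ∀ θ : ℝ, ¬ ((∀ e o : ℕ, i + 1 ≤ e → e ≤ i + d + 1 → i + 1 ≤ o → o ≤ i + d + 1 → Even e →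
      Odd o → b o + s o * θ < b e + s e * θ) ∧ (∀ e o : ℕ, i + 2 ≤ e → e ≤ i + d + 2 → i + 2 ≤ o →
      o ≤ i + d + 2 → Even e → Odd o → b o + s o * θ < b e + s e * θ)))
    (hR : ∀ θ θ' : ℝ, (∀ e o : ℕ, i + 1 ≤ e → e ≤ i + d + 1 → i + 1 ≤ o → o ≤ i + d + 1 → Even e → Odd o →
      b o + s o * θ < b e + s e * θ) → (∀ e o : ℕ, i + 2 ≤ e → e ≤ i + d + 2 → i + 2 ≤ o → o ≤ i + d + 2 →
      Even e → Odd o → b o + s o * θ' < b e + s e * θ') → θ < θ') :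
    s (i + d + 2) < s (i + d + 1) ∧ s (i + d + 1) < s (i + 1) := by
  have hlow1 : ¬ Even (i + 1) := Nat.not_even_iff_odd.mpr (Even.add_one hi)
  have hd1 : 1 ≤ d := by
    obtain ⟨l, hl⟩ := hd
    omega
  have hup1 : Even (i + d + 1) := by
    obtain ⟨k, hk⟩ := hi
    obtain ⟨l, hl⟩ := hd
    exact ⟨k + l + 1, by omega⟩
  have hlow2 : ¬ Even (i + d + 2) := by
    obtain ⟨k, hk⟩ := hi
    obtain ⟨l, hl⟩ := hd
    exact Nat.not_even_iff_odd.mpr ⟨k + l + 1, by omega⟩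
  obtain ⟨θA, hθA⟩ := hA
  obtain ⟨θB, hθB⟩ := hB
  obtain ⟨θB', hθB'⟩ := hB'
  have key := zigzag_core (fun n => Even n) (fun t => - s t) b i d hlow1 hup1 hlow2 hd1
    ⟨-θA, fun e o h1 h2 h3 h4 he ho => by
      have := hθA e o h1 h2 h3 h4 he (Nat.not_even_iff_odd.mp ho)
      have r1 : -s o * -θA = s o * θA := by ring
      have r2 : -s e * -θA = s e * θA := by ring
      linarith⟩
    ⟨-θB, fun e o h1 h2 h3 h4 he ho => by
      have := hθB e o h1 h2 h3 h4 he (Nat.not_even_iff_odd.mp ho)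
      have r1 : -s o * -θB = s o * θB := by ring
      have r2 : -s e * -θB = s e * θB := by ring
      linarith⟩
    (fun θ θ' hθ hθ' => by
      have := hord (-θ) (-θ')
        (fun e o h1 h2 h3 h4 he ho => by
          have := hθ e o h1 h2 h3 h4 he (Nat.not_even_iff_odd.mpr ho)
          have r1 : s o * -θ = -s o * θ := by ring
          have r2 : s e * -θ = -s e * θ := by ring
          linarith)
        (fun e o h1 h2 h3 h4 he ho => by
          have := hθ' e o h1 h2 h3 h4 he (Nat.not_even_iff_odd.mpr ho)
          have r1 : s o * -θ' = -s o * θ' := by ring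
          have r2 : s e * -θ' = -s e * θ' := by ring
          linarith)
      linarith)
    ⟨-θB', fun e o h1 h2 h3 h4 he ho => by
      have := hθB' e o h1 h2 h3 h4 he (Nat.not_even_iff_odd.mp ho)
      have r1 : -s o * -θB' = s o * θB' := by ring
      have r2 : -s e * -θB' = s e * θB' := by ring
      linarith⟩
    (fun θ hθ => hBB' (-θ)
      ⟨fun e o h1 h2 h3 h4 he ho => by
        have := hθ.1 e o h1 h2 h3 h4 he (Nat.not_even_iff_odd.mpr ho)
        have r1 : s o * -θ = -s o * θ := by ring
        have r2 : s e * -θ = -s e * θ := by ring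
        linarith,
       fun e o h1 h2 h3 h4 he ho => by
        have := hθ.2 e o h1 h2 h3 h4 he (Nat.not_even_iff_odd.mpr ho)
        have r1 : s o * -θ = -s o * θ := by ring
        have r2 : s e * -θ = -s e * θ := by ring
        linarith⟩)
    (fun θ θ' hθ hθ' => by
      have := hR (-θ) (-θ')
        (fun e o h1 h2 h3 h4 he ho => by
          have := hθ e o h1 h2 h3 h4 he (Nat.not_even_iff_odd.mpr ho)
          have r1 : s o * -θ = -s o * θ := by ring
          have r2 : s e * -θ = -s e * θ := by ring
          linarith)
        (fun e o h1 h2 h3 h4 he ho => by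
          have := hθ' e o h1 h2 h3 h4 he (Nat.not_even_iff_odd.mpr ho)
          have r1 : s o * -θ' = -s o * θ' := by ring
          have r2 : s e * -θ' = -s e * θ' := by ring
          linarith)
      linarith)
  constructor <;> linarith [key.1, key.2]
end Summit.ValiantsHypothesis.ValiantsHypothesis.Theorems.KPlusLogSqLawStepZigzag
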